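import Literature.MathematicalPhysics.QuantumFieldTheory.ConformalBootstrap3D.PointKernelK34v2Data
import Literature.MathematicalPhysics.QuantumFieldTheory.ConformalBootstrap3D.PointKernelParts

/-!
# K34v2 certificate, kernel part file P64: one-cell head segments 170, 171 in level ranges

The head cells whose kernel evaluation exceeds one `decide` are one-cell segments of `hsegsK34v2`; each is
checked by `PCert.hPartSideOK` (side conditions) and `PCert.hPartOK` per level range `[n_lo, n_lo + count)`
against an integer claim, the claims summing to `≥ 0` (`PointKernel.partsOK`); soundness is
`PCert.hParts_sound` (`PointKernelParts`).  The part files `P1, P2, …` are mutually independent (each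
imports only the data file); the ranges of one cell may span several of them, and the per-cell
conclusions `hparts_i` / `hcell_i` of those cells are assembled in `PointKernelK34v2.lean`.
Estimated kernel time 230 s.
-/

set_option maxRecDepth 100000
set_option maxHeartbeats 0

namespace Literature.MathematicalPhysics.QuantumFieldTheory.ConformalBootstrap3D.PointKernelK34v2

open Literature.MathematicalPhysics.QuantumFieldTheory.ConformalBootstrap3D.PointKernel

/-- levels `[30, 43)` of segment 170: partial lower sum `≥` claim. [folklore] -/
theorem part_170_1 : certK34v2.hPartOK (PCert.segAt hsegsK34v2 170) JHK34v2 30 13 (19439072224064077780191665198869674719) = true := by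
  decide +kernel

/-- levels `[43, 52)` of segment 170: partial lower sum `≥` claim. [folklore] -/
theorem part_170_2 : certK34v2.hPartOK (PCert.segAt hsegsK34v2 170) JHK34v2 43 9 (4110571163166232636231704640359940881) = true := by
  decide +kernel

/-- levels `[52, 57)` of segment 170: partial lower sum `≥` claim. [folklore] -/
theorem part_170_3 : certK34v2.hPartOK (PCert.segAt hsegsK34v2 170) JHK34v2 52 5 (828379795917647757492081613498358252) = true := by
  decide +kernel

/-- one-cell segment 171 (row 6, cell `[1801/256, 901/128]`, chord, `n_F = 48`,
3 level ranges): side conditions. [folklore] -/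
theorem pside_171 : certK34v2.hPartSideOK (PCert.segAt hsegsK34v2 171) JHK34v2 = true := by
  decide +kernel

/-- its level ranges `(n_lo, count, claim)`. [folklore] -/
def parts_171 : List (ℕ × ℕ × ℤ) := [(0, 31, -20686487462459064056497024100046544929), (31, 13, 18054919097642721836106215434364934925), (44, 5, 2631568364816342220390808665681610005)]

/-- the ranges tile `[0, n_F]` and the claims sum to `≥ 0`. [folklore] -/
theorem pcov_171 : PointKernel.partsOK 48 parts_171 = true := by
  decide +kernel

/-- levels `[0, 31)` of segment 171: partial lower sum `≥` claim. [folklore] -/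
theorem part_171_0 : certK34v2.hPartOK (PCert.segAt hsegsK34v2 171) JHK34v2 0 31 (-20686487462459064056497024100046544929) = true := by
  decide +kernel

end Literature.MathematicalPhysics.QuantumFieldTheory.ConformalBootstrap3D.PointKernelK34v2
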